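import Summits.ResolutionOfSingularities.ResolutionOfSingularities.Theorems.PurelyInseparableDim4ParamCertSeven
import HarnessLib

/-!
# [OURS · res-dim4-pi · F4-C-loc] PARAMETRIC CERTIFICATES, format v7 with EXTERNAL ROWS: a table may cite the term lists of
  an EARLIER certified table as «later rows» — so one root's certificate can span several files of ≤ 400 lines

Cell `res-dim4-pi` (D-0157 DOOR 2, wave 2), seat `res-dim4-p-6` g4; sequel of `…ParamCertSeven`.  Sixteen 2-monomial census
roots (among them 15 of the former 53 FAIL rows) have torus-rule tables of 130–470 rows, too long for one tree file.  Here the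
v7 row check takes an extra list `ext : List (Terms 5 k)` of EXTERNALLY certified families, appended (as dummy-certified v6
rows, `ext6`) to the later rows wherever a child is looked up:

* `prow7EB q ext rest row`, **`pcert7EB q ext T`**;
* soundness **`pwin_of_pcert7EB`** under the hypothesis `hext : ∀ L ∈ ext, ∀ β ≠ 0, ∀ r exc, RWins q localB ⟨spec f β (evalT L), r, exc⟩`;
* the chaining form **`rows_certified_of_pcert7EB`** (conclusion of the same shape for `T.map Prod.fst`, to be fed as the next
  file's `hext`), `rows_certified_nil`, and the entry **`rWins_liftState_of_pcert7EB`**.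

[OURS · counted 0 · certificate format + soundness; AI kernel work, weaker than expert review.]  NOTHING here is a statement
about resolution of singularities; resolution in dimension `≥ 4` / characteristic `p > 0` is NOT proved by anything in this
file.  bears_on: LADDER-RESOLUTION:D157-DOOR2 (res-dim4-pi · F4-C-loc all fields · rows v7, multi-file).  Host item (DR-157-C):
`stmt-ResolutionOfSingularities-16155`, helper.
-/

set_option linter.dupNamespace false -- mandated namespace of this single-conjunct summit

noncomputable section

open MvPolynomial Finset
open scoped BigOperators

namespace Summit.ResolutionOfSingularities.ResolutionOfSingularities.Theorems.PIDim4

namespace LoopCLocal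

open Literature.AlgebraicGeometry.Resolution
open Literature.AlgebraicGeometry.Resolution.Hauser2010
open Literature.AlgebraicGeometry.Resolution.CentreBlowup
open StepKit ParamLift

section Format

variable {k : Type} [Field k] [DecidableEq k]

/-! ## §1 The checker with external rows -/

/-- external term lists as dummy-certified v6 rows. OURS. [folklore] -/
def ext6 (ext : List (Terms 5 k)) : List (PRow6 k) := ext.map fun L => (L, PRowCert6.move ∅ fun _ => PNode6.child)

/-- the v7 row check with external rows. OURS. [folklore] -/
def prow7EB (q : ℕ) (ext : List (Terms 5 k)) (rest : List (PRow7 k)) : PRow7 k → Bool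
  | (L, PRowCert7.six c) => prow6B q (proj6 rest ++ ext6 ext) (L, c)
  | (L, PRowCert7.torus w N) =>
      decide (∀ t ∈ L, (t.1 (Fin.last 4) : ℤ) + ∑ i : Fin 4, w i * (t.1 i.castSucc : ℤ) = N) &&
        memRow6B (normT (setT0 L)) (proj6 rest ++ ext6 ext)
  | (L, PRowCert7.pin γ d₀ A rts) =>
      !decide (γ = 0) && decide (∑ i, γ i < q) && !decide (A = 0) &&
        decide (∀ t ∈ L, Fin.init t.1 = γ → t.1 (Fin.last 4) < (rootsPolyL A d₀ rts []).length) &&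
        ((List.range (rootsPolyL A d₀ rts []).length).all fun a =>
          decide (tCoef γ L a = (rootsPolyL A d₀ rts []).getD a 0)) &&
        decide (∀ ρm ∈ rts, memRow6B (normT (pinT ρm.1 L)) (proj6 rest ++ ext6 ext) = true)

/-- **the v7 checker with external rows.** OURS. [folklore] -/
def pcert7EB (q : ℕ) (ext : List (Terms 5 k)) : List (PRow7 k) → Bool
  | [] => true
  | row :: rest => prow7EB q ext rest row && pcert7EB q ext rest

end Format

/-! ## §2 Soundness -/

section Sound

variable {k K : Type} [Field k] [Field K] [DecidableEq k] [DecidableEq K] (f : k →+* K)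

omit [DecidableEq k] in
/-- the v6-level hypothesis for `proj6 rest ++ ext6 ext`. OURS. [folklore] -/
theorem hrest_append {q : ℕ} {rest : List (PRow7 k)} {ext : List (Terms 5 k)}
    (hrest : ∀ row ∈ rest, (∀ β : K, β ≠ 0 → ∀ (r : Fin 4 →₀ ℕ) (exc : Finset (Fin 4)),
      RWins q localB (⟨spec f β (evalT row.1), r, exc⟩ : State K)))
    (hext : ∀ L ∈ ext, (∀ β : K, β ≠ 0 → ∀ (r : Fin 4 →₀ ℕ) (exc : Finset (Fin 4)),
      RWins q localB (⟨spec f β (evalT L), r, exc⟩ : State K))) :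
    ∀ row ∈ proj6 rest ++ ext6 ext, (∀ β : K, β ≠ 0 → ∀ (r : Fin 4 →₀ ℕ) (exc : Finset (Fin 4)),
      RWins q localB (⟨spec f β (evalT row.1), r, exc⟩ : State K)) := by
  intro row hrow
  rcases List.mem_append.mp hrow with h | h
  · exact hrest_proj6 f hrest row h
  · unfold ext6 at h
    obtain ⟨L, hL, rfl⟩ := List.mem_map.mp h
    exact hext L hL

/-- soundness of a TORUS row against any certified v6 row list. OURS. [folklore] -/
theorem pwin_of_torus6 {q : ℕ} {rows : List (PRow6 k)}
    (hrows : ∀ row ∈ rows, (∀ β : K, β ≠ 0 → ∀ (r : Fin 4 →₀ ℕ) (exc : Finset (Fin 4)),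
      RWins q localB (⟨spec f β (evalT row.1), r, exc⟩ : State K))) {L : Terms 5 k} {w : Fin 4 → ℤ} {N : ℤ}
    (haff : ∀ t ∈ L, (t.1 (Fin.last 4) : ℤ) + ∑ i : Fin 4, w i * (t.1 i.castSucc : ℤ) = N)
    (hmem : memRow6B (normT (setT0 L)) rows = true) {β : K} (hβ : β ≠ 0) (r : Fin 4 →₀ ℕ) (exc : Finset (Fin 4)) :
    RWins q localB (⟨spec f β (evalT L), r, exc⟩ : State K) := by
  rw [spec_eq_C_mul_scale_of_affine f hβ L haff,
    Torus.rWins_C_mul_scale_iff (zpow_ne_zero _ hβ) (fun i => zpow_ne_zero _ hβ)]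
  have hw := pwin_of_memRow6B f hrows hmem β hβ r exc
  rwa [evalT_normT] at hw

/-- soundness of a PIN row against any certified v6 row list. OURS. [folklore] -/
theorem pwin_of_pin6 {q : ℕ} {rows : List (PRow6 k)}
    (hrows : ∀ row ∈ rows, (∀ β : K, β ≠ 0 → ∀ (r : Fin 4 →₀ ℕ) (exc : Finset (Fin 4)),
      RWins q localB (⟨spec f β (evalT row.1), r, exc⟩ : State K))) {L : Terms 5 k} {γ : Fin 4 → ℕ} {A : k}
    {d₀ : ℕ} {rts : List (k × ℕ)} (hγq : ∑ i, γ i < q) (hA : A ≠ 0)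
    (hM : ∀ t ∈ L, Fin.init t.1 = γ → t.1 (Fin.last 4) < (rootsPolyL A d₀ rts []).length)
    (hcoef : ∀ a, a < (rootsPolyL A d₀ rts []).length → tCoef γ L a = (rootsPolyL A d₀ rts []).getD a 0)
    (hpins : ∀ ρm ∈ rts, memRow6B (normT (pinT ρm.1 L)) rows = true) {β : K} (hβ : β ≠ 0)
    (r : Fin 4 →₀ ℕ) (exc : Finset (Fin 4)) : RWins q localB (⟨spec f β (evalT L), r, exc⟩ : State K) := by
  set R := rootsPolyL A d₀ rts [] with hR
  have hco : coeff (expo γ) (spec f β (evalT L)) = evalL f R β := by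
    rw [coeff_spec_eq_sum_tCoef f β γ R.length L hM, evalL_eq_sum]
    exact Finset.sum_congr rfl fun a ha => by rw [hcoef a (Finset.mem_range.mp ha)]
  by_cases hzero : evalL f R β = 0
  · rcases root_cases_of_eval_eq_zero f hA hzero with ⟨-, hβ0⟩ | ⟨ρm, hρm, hβρ⟩ | ⟨c, hc, -⟩
    · exact absurd hβ0 hβ
    · rw [hβρ, spec_pin_eq f ρm.1 β L, ← evalT_normT]
      exact pwin_of_memRow6B f hrows (hpins ρm hρm) β hβ r exc
    · exact absurd hc List.not_mem_nil
  · rw [← hco] at hzero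
    exact Game.Wins.terminal fun S hS => not_isPermissibleCentre_of_coeff_ne_zero hγq hzero S hS.2

/-- **soundness of one row** (external rows certified by `hext`). OURS. [folklore] -/
theorem pwin_of_prow7EB {q : ℕ} (hq : 2 ≤ q) {ext : List (Terms 5 k)} {rest : List (PRow7 k)}
    (hrest : ∀ row ∈ rest, (∀ β : K, β ≠ 0 → ∀ (r : Fin 4 →₀ ℕ) (exc : Finset (Fin 4)),
      RWins q localB (⟨spec f β (evalT row.1), r, exc⟩ : State K)))
    (hext : ∀ L ∈ ext, (∀ β : K, β ≠ 0 → ∀ (r : Fin 4 →₀ ℕ) (exc : Finset (Fin 4)),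
      RWins q localB (⟨spec f β (evalT L), r, exc⟩ : State K))) {row : PRow7 k}
    (h : prow7EB q ext rest row = true) :
    (∀ β : K, β ≠ 0 → ∀ (r : Fin 4 →₀ ℕ) (exc : Finset (Fin 4)),
      RWins q localB (⟨spec f β (evalT row.1), r, exc⟩ : State K)) := by
  have hrows := hrest_append f hrest hext
  obtain ⟨L, cert⟩ := row
  intro β hβ r exc
  cases cert with
  | six c =>
    simp only [prow7EB] at h
    exact pwin_of_prow6B f hq hrows h β hβ r exc
  | torus w N =>
    simp only [prow7EB, Bool.and_eq_true, decide_eq_true_eq] at h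
    exact pwin_of_torus6 f hrows h.1 h.2 hβ r exc
  | pin γ d₀ A rts =>
    simp only [prow7EB, Bool.and_eq_true, Bool.not_eq_true', decide_eq_false_iff_not, decide_eq_true_eq,
      List.all_eq_true, List.mem_range] at h
    obtain ⟨⟨⟨⟨⟨-, hγq⟩, hA⟩, hM⟩, hcoef⟩, hpins⟩ := h
    exact pwin_of_pin6 f hrows hγq hA hM hcoef hpins hβ r exc

/-- **SOUNDNESS WITH EXTERNAL ROWS**: every row of a checked table is certified, given that the external rows are.
OURS. [folklore] -/
theorem pwin_of_pcert7EB {q : ℕ} (hq : 2 ≤ q) {ext : List (Terms 5 k)}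
    (hext : ∀ L ∈ ext, (∀ β : K, β ≠ 0 → ∀ (r : Fin 4 →₀ ℕ) (exc : Finset (Fin 4)),
      RWins q localB (⟨spec f β (evalT L), r, exc⟩ : State K))) :
    ∀ {T : List (PRow7 k)}, pcert7EB q ext T = true → ∀ row ∈ T,
      (∀ β : K, β ≠ 0 → ∀ (r : Fin 4 →₀ ℕ) (exc : Finset (Fin 4)),
        RWins q localB (⟨spec f β (evalT row.1), r, exc⟩ : State K))
  | [], _ => fun row hrow => absurd hrow List.not_mem_nil
  | row :: rest, h => by
    unfold pcert7EB at h
    rw [Bool.and_eq_true] at h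
    have hrest := pwin_of_pcert7EB hq hext h.2
    intro r hr
    rcases List.mem_cons.mp hr with rfl | hr'
    · exact pwin_of_prow7EB f hq hrest hext h.1
    · exact hrest r hr'

/-- **the chaining form**: the TERM LISTS of a checked table are certified (the shape of the next file's `hext`).
OURS. [folklore] -/
theorem rows_certified_of_pcert7EB {q : ℕ} (hq : 2 ≤ q) {ext : List (Terms 5 k)}
    (hext : ∀ L ∈ ext, (∀ β : K, β ≠ 0 → ∀ (r : Fin 4 →₀ ℕ) (exc : Finset (Fin 4)),
      RWins q localB (⟨spec f β (evalT L), r, exc⟩ : State K))) {T : List (PRow7 k)} (h : pcert7EB q ext T = true) :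
    ∀ L ∈ T.map Prod.fst, (∀ β : K, β ≠ 0 → ∀ (r : Fin 4 →₀ ℕ) (exc : Finset (Fin 4)),
      RWins q localB (⟨spec f β (evalT L), r, exc⟩ : State K)) := by
  intro L hL
  obtain ⟨row, hrow, rfl⟩ := List.mem_map.mp hL
  exact pwin_of_pcert7EB f hq hext h row hrow

omit [DecidableEq k] in
/-- the empty external list is certified. OURS. [folklore] -/
theorem rows_certified_nil {q : ℕ} : ∀ L ∈ ([] : List (Terms 5 k)),
    (∀ β : K, β ≠ 0 → ∀ (r : Fin 4 →₀ ℕ) (exc : Finset (Fin 4)),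
      RWins q localB (⟨spec f β (evalT L), r, exc⟩ : State K)) := fun _ hL => absurd hL List.not_mem_nil

omit [DecidableEq k] in
/-- concatenating certified external lists. OURS. [folklore] -/
theorem rows_certified_append {q : ℕ} {E₁ E₂ : List (Terms 5 k)}
    (h₁ : ∀ L ∈ E₁, (∀ β : K, β ≠ 0 → ∀ (r : Fin 4 →₀ ℕ) (exc : Finset (Fin 4)),
      RWins q localB (⟨spec f β (evalT L), r, exc⟩ : State K)))
    (h₂ : ∀ L ∈ E₂, (∀ β : K, β ≠ 0 → ∀ (r : Fin 4 →₀ ℕ) (exc : Finset (Fin 4)),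
      RWins q localB (⟨spec f β (evalT L), r, exc⟩ : State K))) :
    ∀ L ∈ E₁ ++ E₂, (∀ β : K, β ≠ 0 → ∀ (r : Fin 4 →₀ ℕ) (exc : Finset (Fin 4)),
      RWins q localB (⟨spec f β (evalT L), r, exc⟩ : State K)) := fun L hL => by
  rcases List.mem_append.mp hL with h | h
  · exact h₁ L h
  · exact h₂ L h

end Sound

/-! ## §3 Entry point -/

/-- **an `𝔽₃` state whose embedding heads a checked v7 table with certified external rows is a LOCAL A-win over the field
`L` of characteristic 3.** OURS. [folklore] -/
theorem rWins_liftState_of_pcert7EB (L : Type) [Field L] [CharP L 3] [DecidableEq L] {ext : List (Terms 5 (ZMod 3))}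
    (hext : ∀ T5 ∈ ext, (∀ β : L, β ≠ 0 → ∀ (r : Fin 4 →₀ ℕ) (exc : Finset (Fin 4)),
      RWins 3 localB (⟨spec (φ3 L) β (evalT T5), r, exc⟩ : State L)))
    {s : SData 4 (ZMod 3)} {cert : PRowCert7 (ZMod 3)} {rest : List (PRow7 (ZMod 3))}
    (h : pcert7EB 3 ext ((embed s.L, cert) :: rest) = true) : RWins 3 localB (liftState L s.toState) := by
  have hw := pwin_of_pcert7EB (φ3 L) (by norm_num) hext h (embed s.L, cert) List.mem_cons_self 1 one_ne_zero
    (expo s.r) s.exc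
  rw [spec_embed] at hw
  exact hw

end LoopCLocal

end Summit.ResolutionOfSingularities.ResolutionOfSingularities.Theorems.PIDim4

end
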